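/-
COR-CM (cell pub-hodgecm2, stage 2 of the Hodge ladder) — Δ2 BRIDGE, X1 pin «J» (ASSEMBLER DECISION #3, HOME/INBOX l.10797): the
model's tower `H = colim_K H¹(X_K(ℂ); ℂ)` IS the complexification of a RATIONAL tower, injectively — the `ι : ℂ ⊗_ℚ U →ₗ[ℂ] H_B`,
`ι_injective`, `ι_comm` fields of the proof's record `Map43RationalData` at the pin.  THIS FILE: the three pieces of pure linear
algebra that construction needs and Mathlib does not have in this form (Mathlib-only imports; the tower itself is port-gated and is
treated in `CorCM/D2Bridge/TowerRationalForm.lean`).  Seat prover-pub-hodgecm2-d2bridge-prove-3-g0-0 (d2bridge-prove-3).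
THEOREMS ONLY; no `sorry`.  HC_CM is NOT proved; nothing here is a display or a pointer move.
-/
import Mathlib.LinearAlgebra.TensorProduct.Pi
import Mathlib.LinearAlgebra.TensorProduct.Tower
import Mathlib.LinearAlgebra.DirectSum.Finsupp
import Mathlib.LinearAlgebra.FreeModule.Basic
import Mathlib.LinearAlgebra.Span.Basic
import Mathlib.LinearAlgebra.Basis.VectorSpace
import Mathlib.Algebra.Colimit.Module
import Mathlib.RingTheory.Flat.Basic
import HarnessLib

/-!
# Δ2 bridge, pin J — toolkit: complexification of rational forms is injective (three linear-algebra lemmas)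

For the rational form `U` of the model's tower (`TowerRationalForm.lean`) — `U = colim_K U_K` with
`U_K ⊆ Π_h H¹(P_{Γ_h}(ℂ); ℚ)` — the comparison `ι : ℂ ⊗_ℚ U → H = colim_K H_K`, `H_K ⊆ Π_h ℂ ⊗_ℚ H¹(P_{Γ_h}(ℂ); ℚ)`, is
injective because, level by level, `ℂ ⊗_ℚ U_K → ℂ ⊗_ℚ Π_h M_h → Π_h ℂ ⊗_ℚ M_h` is injective and every element of
`ℂ ⊗_ℚ colim_K U_K` comes from one level.  The three facts, in the generality Mathlib's API makes natural:

* `TensorProduct.piRightHom_injective_of_free` — for `N` FREE over `R`, `N ⊗_R (Π_i M_i) → Π_i (N ⊗_R M_i)`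
  (`TensorProduct.piRightHom`, an isomorphism only for finite index types) is INJECTIVE for every family (coordinates in a
  basis of `N`: `N ⊗_R X ≃ (κ →₀ X)` naturally in `X`, and a finitely supported family of elements of `Π_i M_i` vanishes iff all
  its coordinates do);
* `TensorProduct.tmul_left_injective_of_ne_zero` — over a field, `x ↦ e ⊗ x : M → S ⊗_R M` is injective for `e ≠ 0`
  (a linear retraction `S → R`, `e ↦ 1`); in particular `x ↦ 1 ⊗ x : M → ℂ ⊗_ℚ M`;
* `LinearMap.baseChange_injective` — base change to a flat algebra preserves injectivity (Mathlib's
  `Module.Flat.lTensor_preserves_injective_linearMap` in the `baseChange` spelling);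
* `Module.DirectLimit.exists_lTensor_of` — every element of `A ⊗_R colim_i G_i` is `(of i ⊗ A) s` for ONE index `i`
  (directedness; the tensor analogue of `Module.DirectLimit.exists_of`).

All folklore linear algebra. [folklore]
-/

noncomputable section

open scoped TensorProduct
open Function

namespace TensorProduct

/-! ## `N ⊗ Π M_i → Π (N ⊗ M_i)` is injective for `N` free -/

section PiRight

variable (R : Type*) [CommRing R] (N : Type*) [AddCommGroup N] [Module R N]

/-- **`N ⊗_R (Π_i M_i) → Π_i (N ⊗_R M_i)` is injective when `N` is free over `R`** (for every index type; Mathlib's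
`TensorProduct.piRight` is the finite case, where it is bijective).  Proof: in a basis `b` of `N`, `N ⊗_R X ≃ (κ →₀ X)`
(`TensorProduct.congr b.repr _ ≪≫ₗ finsuppScalarLeft`), naturally in `X`; the `i`-th component of `piRightHom t` is `(1 ⊗ proj_i) t`,
whose coordinates are the `i`-th components of the coordinates of `t`; so `piRightHom t = 0` kills every coordinate of `t`. [folklore] -/
theorem piRightHom_injective_of_free (S : Type*) [CommRing S] [Algebra R S] [Module S N] [IsScalarTower R S N]
    [Module.Free R N] {ι : Type*} (M : ι → Type*) [∀ i, AddCommGroup (M i)] [∀ i, Module R (M i)] :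
    Injective (piRightHom R S N M) := by
  classical
  let b := Module.Free.chooseBasis R N
  -- coordinates in the basis `b`, for the product and for each factor
  let eP : N ⊗[R] (∀ i, M i) ≃ₗ[R] (Module.Free.ChooseBasisIndex R N →₀ ∀ i, M i) :=
    (TensorProduct.congr b.repr (LinearEquiv.refl R _)).trans (finsuppScalarLeft R _ _)
  let eI : ∀ i, N ⊗[R] M i ≃ₗ[R] (Module.Free.ChooseBasisIndex R N →₀ M i) := fun i =>
    (TensorProduct.congr b.repr (LinearEquiv.refl R _)).trans (finsuppScalarLeft R _ _)
  have heP : ∀ (n : N) (x : ∀ i, M i) (k), eP (n ⊗ₜ x) k = b.repr n k • x := fun n x k => by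
    simp [eP, finsuppScalarLeft_apply_tmul_apply]
  have heI : ∀ i (n : N) (x : M i) (k), eI i (n ⊗ₜ x) k = b.repr n k • x := fun i n x k => by
    simp [eI, finsuppScalarLeft_apply_tmul_apply]
  -- the `i`-th component of `piRightHom` is `1 ⊗ proj_i`, and its coordinates are the `i`-th components of the coordinates
  have hnat : ∀ (u : N ⊗[R] (∀ i, M i)) (i : ι) (k), eI i (piRightHom R S N M u i) k = eP u k i := by
    intro u i k
    induction u using TensorProduct.induction_on with
    | zero => simp only [map_zero, Pi.zero_apply, Finsupp.coe_zero]
    | tmul n m => rw [piRightHom_tmul, heI, heP, Pi.smul_apply]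
    | add s t hs ht => simp only [map_add, Pi.add_apply, Finsupp.coe_add, hs, ht]
  intro s t hst
  rw [← sub_eq_zero] at hst ⊢
  rw [← map_sub] at hst
  set u := s - t with hu
  apply eP.injective
  rw [map_zero]
  ext k i
  rw [← hnat u i k, hst, Pi.zero_apply, map_zero, Finsupp.coe_zero, Pi.zero_apply, Finsupp.coe_zero, Pi.zero_apply,
    Pi.zero_apply]

end PiRight

/-! ## `x ↦ e ⊗ x` is injective for `e ≠ 0` over a field -/

/-- **Over a field, tensoring with a non-zero vector is injective**: `x ↦ e ⊗ x : M → S ⊗_R M` is injective for `e ≠ 0`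
(a linear form `r : S → R` with `r e = 1` gives the retraction `lid ∘ (r ⊗ 1)`).  Used with `R = ℚ`, `S = ℂ`, `e = 1`: a rational
family is recovered from its complexification. [folklore] -/
theorem tmul_left_injective_of_ne_zero {R : Type*} [Field R] {S : Type*} [AddCommGroup S] [Module R S] {e : S} (he : e ≠ 0)
    (M : Type*) [AddCommGroup M] [Module R M] : Injective (fun x : M => e ⊗ₜ[R] x) := by
  obtain ⟨r, hr⟩ := LinearMap.exists_leftInverse_of_injective (LinearMap.toSpanSingleton R S e)
    (LinearMap.ker_toSpanSingleton R he)
  have hre : r e = 1 := by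
    have := LinearMap.congr_fun hr (1 : R)
    rwa [LinearMap.comp_apply, LinearMap.toSpanSingleton_apply_one, LinearMap.id_apply] at this
  intro x y hxy
  have h := congrArg (fun t => TensorProduct.lid R M (r.rTensor M t)) hxy
  simpa only [LinearMap.rTensor_tmul, hre, TensorProduct.lid_tmul, one_smul] using h

/-- The case of record: **`x ↦ 1 ⊗ x : M → S ⊗_R M` is injective** for a non-trivial `R`-algebra `S` over a field `R`
(e.g. `ℚ → ℂ`). [folklore] -/
theorem one_tmul_injective (R : Type*) [Field R] (S : Type*) [CommRing S] [Algebra R S] [Nontrivial S]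
    (M : Type*) [AddCommGroup M] [Module R M] : Injective (fun x : M => (1 : S) ⊗ₜ[R] x) :=
  tmul_left_injective_of_ne_zero (R := R) (S := S) one_ne_zero M

end TensorProduct

/-! ## Base change to a flat algebra preserves injectivity -/

/-- **`f.baseChange A` is injective for `f` injective and `A` flat** (Mathlib's `Module.Flat.lTensor_preserves_injective_linearMap`,
`baseChange` spelling). [folklore] -/
theorem LinearMap.baseChange_injective {R : Type*} [CommRing R] (A : Type*) [CommRing A] [Algebra R A] [Module.Flat R A]
    {M N : Type*} [AddCommGroup M] [Module R M] [AddCommGroup N] [Module R N] (f : M →ₗ[R] N) (hf : Injective f) :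
    Injective (f.baseChange A) := by
  rw [LinearMap.baseChange_eq_ltensor]
  exact Module.Flat.lTensor_preserves_injective_linearMap f hf

/-! ## Elements of `A ⊗ colim G` come from one level -/

/-- **Every element of `A ⊗_R colim_i G_i` is the image of `A ⊗_R G_i` for a single index `i`** (the system being directed):
the tensor analogue of `Module.DirectLimit.exists_of`. [folklore] -/
theorem Module.DirectLimit.exists_lTensor_of {R : Type*} [CommRing R] {ι : Type*} [Preorder ι] [DecidableEq ι] [Nonempty ι]
    [IsDirectedOrder ι] (G : ι → Type*) [∀ i, AddCommGroup (G i)] [∀ i, Module R (G i)]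
    (f : ∀ i j, i ≤ j → G i →ₗ[R] G j) (A : Type*) [AddCommGroup A] [Module R A]
    (t : A ⊗[R] Module.DirectLimit G f) :
    ∃ (i : ι) (s : A ⊗[R] G i), (Module.DirectLimit.of R ι G f i).lTensor A s = t := by
  induction t using TensorProduct.induction_on with
  | zero => exact ⟨Classical.arbitrary ι, 0, map_zero _⟩
  | tmul a z =>
    obtain ⟨i, x, rfl⟩ := Module.DirectLimit.exists_of z
    exact ⟨i, a ⊗ₜ x, LinearMap.lTensor_tmul _ _ _ _⟩
  | add t₁ t₂ h₁ h₂ =>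
    obtain ⟨i, s₁, rfl⟩ := h₁
    obtain ⟨j, s₂, rfl⟩ := h₂
    obtain ⟨k, hik, hjk⟩ := exists_ge_ge i j
    refine ⟨k, (f i k hik).lTensor A s₁ + (f j k hjk).lTensor A s₂, ?_⟩
    have e₁ : Module.DirectLimit.of R ι G f k ∘ₗ f i k hik = Module.DirectLimit.of R ι G f i :=
      LinearMap.ext fun x => Module.DirectLimit.of_f
    have e₂ : Module.DirectLimit.of R ι G f k ∘ₗ f j k hjk = Module.DirectLimit.of R ι G f j :=
      LinearMap.ext fun x => Module.DirectLimit.of_f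
    rw [map_add, ← LinearMap.comp_apply, ← LinearMap.lTensor_comp, e₁, ← LinearMap.comp_apply
      (f := (Module.DirectLimit.of R ι G f k).lTensor A), ← LinearMap.lTensor_comp, e₂]

end
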